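import Summits.AtomisticToContinuum.HydrodynamicLimit.Theorems.AntiMazurCoboundariesKineticFluxLdDecayObjects
import Summits.AtomisticToContinuum.HydrodynamicLimit.Theorems.JParityClosureOddContactSymmetryGibbsInvariance
import Literature.MathematicalPhysics.KineticTheory.HardSphereBinnedJumpPayload
import Literature.MathematicalPhysics.KineticTheory.HardSphereCanonicalTorus
import Literature.Analysis.FluidPDE.HardSphereCollisionTimeMeasurable
import Literature.Probability.Moments.GaussianNormExpMoment
import HarnessLib

/-!
# Stub S3 `stub_clampedJumpPressure` of the crux line `dynkin-azuma-collision-innovations`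
# (crux `KineticFluxLdDecay`, stmt-AtomisticToContinuum-10967)

Helper file (`--supports stmt-AtomisticToContinuum-10967`) closing the registered stub
`stub_clampedJumpPressure` (S3) of the skeleton
`Cruxes/KineticFluxLdDecay/Lines/dynkin-azuma-collision-innovations.lean`, over the objects module
`AntiMazurCoboundariesKineticFluxLdDecayObjects` (`Flow`, `Phase`, `gibbs`, `ell`, `window`, `sv`,
`collCount`, `busy`, `stopTime`, `counted`, `relTimes`, `relCount`, `relTime`, `horizon`, `bin`,
`binVal`, `clip`, `preVelOf`, `payloadAt`, `payloadCap`, `payloadY`, `procX`).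

**Statement.** `X̃ₘ`, `m = horizon N K = (N+1)(K+1)`, `K = ⌈kτ⌉₊`, is the sum over the RELEVANT collisions
of the window `(0, h]` (`h = window τ N = τℓ`, `ℓ = (N+1)^{-1/3}`) of the binned clipped payloads
`Σ_{i counted} cℓ·φ̃'(xᵢ)·(ψ̃₀(wᵢ⁺) - ψ̃₀(wᵢ⁻))`.  S3: for every tilt `p` and every `δ > 0`, for meshes
`δφ, δ₀ ≤ r₀`, windows `τ ≥ τ₀` and `N ≥ N₀`, `∫ exp(p h⁻¹ X̃ₘ) dG_N ≤ exp(δ(N+1))`, and `X̃ₘ` is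
`G_N`-a.e. measurable — the jump process is a FREE term of the line.

**Proof.** (i) On a good orbit the relevant collision times are the clamped collision times of the
window (`relTimes_eq`): at most `m` of them, listed increasingly by `relTime`, binary collisions make
clipping inactive (`abs_sum_payloadAt_le`), and the sum regroups particle by particle
(`HardSphereFlow.sum_clampedTimes_eq`) — the identity `procX_horizon_eq`, whose right-hand side is
measurable on the good set (`aemeasurable_procX_horizon`).  (ii)+(iii) Binning error per counted jump
and Abel telescoping of the exact payloads of each particle over its counted collisions give
`|X̃ₘ| ≤ (N+1)cℓ(2b + (K+1)(2δφ(b+δ₀)+2δ₀)) + cℓbD Σᵢ∫₀ʰ‖vᵢ‖`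
(`HardSphereFlow.abs_sum_sum_range_ite_binnedJumpPayload_le`).  (iv) Hence
`p h⁻¹X̃ₘ ≤ (2δ/3)(N+1) + h⁻¹∫₀ʰ Σᵢ t‖vᵢ(s)‖ ds`, `t = |p|cℓbD` (`mul_windowInv_procX_le`), and the
window pressure of the one-body `t‖v‖` under the flow-invariant homogeneous Gibbs law is at most
`(N+1) log ∫ e^{t‖v‖} dN(u₀,θ) ≤ (N+1)δ/3` for `t ≤ t₀` (Jensen in time, invariance, Gaussian
factorisation; Fernique), i.e. for `N ≥ N₀` since `ℓ → 0`.

References: C. Kipnis, C. Landim, *Scaling Limits of Interacting Particle Systems* (1999), App. 1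
§5–6; I. Gallagher, L. Saint-Raymond, B. Texier, *From Newton to Boltzmann* (2013), §4.1.
-/

noncomputable section

open MeasureTheory ProbabilityTheory Set Filter
open scoped ENNReal BigOperators Classical
open Literature.Analysis.FluidPDE Literature.MathematicalPhysics.KineticTheory
open Literature.Probability.Moments

namespace Summit.AtomisticToContinuum.HydrodynamicLimit.Theorems.DynkinAzuma

variable {σ : ℝ} {N : ℕ}

/-! ## The clamp and the relevant collision times on the good set -/

/-- On the good set the stopping time of particle `i` is the clamp of
`Literature.Analysis.FluidPDE.HardSphereWindowEnumeration`: the time of its collision of index `K`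
if it has at least `K + 1` collisions in `(0, h]`, else `h`. [folklore] -/
theorem stopTime_eq_clamp (Φ : Flow σ N) (K : ℕ) (h : ℝ) (i : Fin (N + 1)) {z : Phase N}
    (hz : z ∈ Φ.good) :
    stopTime Φ K h i z =
      if K + 1 ≤ (collisionTimesOf (Torus.geometry (Fin 3)) (hsDiameter σ N) (fun s => Φ.flow s z) i ∩
          Set.Ioc 0 h).ncard then max 0 (min h (Φ.nthCollisionTimeOf i K z)) else h := by
  unfold stopTime busy collCount
  by_cases hK : K + 1 ≤ (collisionTimesOf (Torus.geometry (Fin 3)) (hsDiameter σ N)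
    (fun s => Φ.flow s z) i ∩ Set.Ioc 0 h).ncard
  · simp [hK, hz]
  · simp [hK]

/-- A particle is counted at time `t` iff it participates and `t` is not later than its clamp
(good set). [folklore] -/
theorem counted_eq_true_iff (Φ : Flow σ N) (K : ℕ) (h : ℝ) (t : ℝ) (i : Fin (N + 1))
    {z : Phase N} (hz : z ∈ Φ.good) :
    counted Φ K h t i z = true ↔
      Participates (Torus.geometry (Fin 3)) (hsDiameter σ N) (Φ.flow t z) i ∧
        t ≤ (if K + 1 ≤ (collisionTimesOf (Torus.geometry (Fin 3)) (hsDiameter σ N)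
              (fun s => Φ.flow s z) i ∩ Set.Ioc 0 h).ncard then
            max 0 (min h (Φ.nthCollisionTimeOf i K z)) else h) := by
  rw [counted, decide_eq_true_iff, stopTime_eq_clamp Φ K h i hz]

/-- **The relevant collision times are the clamped collision times of the window.** [folklore] -/
theorem relTimes_eq (Φ : Flow σ N) (K : ℕ) (h : ℝ) {z : Phase N} (hz : z ∈ Φ.good) :
    relTimes Φ K h z =
      {t | t ∈ collisionTimes (Torus.geometry (Fin 3)) (hsDiameter σ N) (fun s => Φ.flow s z) ∧
        t ∈ Set.Ioc 0 h ∧ ∃ i, Participates (Torus.geometry (Fin 3)) (hsDiameter σ N) (Φ.flow t z) i ∧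
          t ≤ (if K + 1 ≤ (collisionTimesOf (Torus.geometry (Fin 3)) (hsDiameter σ N)
                (fun s => Φ.flow s z) i ∩ Set.Ioc 0 h).ncard then
              max 0 (min h (Φ.nthCollisionTimeOf i K z)) else h)} := by
  ext t
  simp only [relTimes, mem_setOf_eq, counted_eq_true_iff Φ K h t _ hz]

/-- The relevant collision times of a good orbit are finitely many. [folklore] -/
theorem finite_relTimes (Φ : Flow σ N) (K : ℕ) (h : ℝ) {z : Phase N} (hz : z ∈ Φ.good) :
    (relTimes Φ K h z).Finite :=
  (Φ.finite_collisionTimes_inter hz (S := Set.Ioc 0 h) Ioc_subset_Icc_self).subset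
    fun _ ht => ⟨ht.1, ht.2.1⟩

/-- Clipping is inactive below the cap. [folklore] -/
theorem clip_eq_self_of_abs_le {R x : ℝ} (h : |x| ≤ R) : clip R x = x := by
  unfold clip
  rw [abs_le] at h
  rw [min_eq_right h.2, max_eq_right h.1]

/-- **Clipping is inactive on good orbits**: at most two particles participate at any time and each
counted payload is at most `4cℓ(b + δ₀)` (`δφ ≤ 1`), so the total is within the cap `8cℓ(b + δ₀)`.
[folklore] -/
theorem abs_sum_payloadAt_le (θ : ℝ) (u₀ : V3) {φ' : T3 → ℝ} {ψ₀ : V3 → ℝ} {c b δφ δ₀ : ℝ}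
    (hc : 0 ≤ c) (hφ1 : ∀ x, |φ' x| ≤ 1) (hψb : ∀ v, |ψ₀ v| ≤ b) (hδφ : 0 < δφ) (hδφ1 : δφ ≤ 1)
    (hδ₀ : 0 < δ₀) (K : ℕ) (h : ℝ) (Φ : Flow σ N) {z : Phase N} (hz : z ∈ Φ.good) (t : ℝ) :
    |∑ i, payloadAt θ u₀ φ' ψ₀ c K h δφ δ₀ Φ t z i| ≤ payloadCap c b δ₀ N := by
  have hb : 0 ≤ b := (abs_nonneg _).trans (hψb 0)
  have hℓ := (ell_pos N).le
  -- the payload in `if Participates ∧ clamped then term else 0` form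
  have hform : ∀ i, payloadAt θ u₀ φ' ψ₀ c K h δφ δ₀ Φ t z i =
      if Participates (Torus.geometry (Fin 3)) (hsDiameter σ N) (Φ.flow t z) i ∧
          t ≤ (if K + 1 ≤ (collisionTimesOf (Torus.geometry (Fin 3)) (hsDiameter σ N)
                (fun s => Φ.flow s z) i ∩ Set.Ioc 0 h).ncard then
              max 0 (min h (Φ.nthCollisionTimeOf i K z)) else h) then
        c * ell N * binVal δφ (φ' (Φ.flow t z i).1) *
          (binVal δ₀ (ψ₀ (sv θ u₀ (Φ.flow t z i).2)) -
            binVal δ₀ (ψ₀ (sv θ u₀ (preVelOf (σ := σ) (Φ.flow t z) i)))) else 0 := by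
    intro i
    unfold payloadAt
    by_cases hP : Participates (Torus.geometry (Fin 3)) (hsDiameter σ N) (Φ.flow t z) i ∧
        t ≤ (if K + 1 ≤ (collisionTimesOf (Torus.geometry (Fin 3)) (hsDiameter σ N)
              (fun s => Φ.flow s z) i ∩ Set.Ioc 0 h).ncard then
            max 0 (min h (Φ.nthCollisionTimeOf i K z)) else h)
    · rw [if_pos ((counted_eq_true_iff Φ K h t i hz).2 hP), if_pos hP]
    · rw [if_neg (fun h' => hP ((counted_eq_true_iff Φ K h t i hz).1 h')), if_neg hP]
  simp only [hform]
  have hterm : ∀ i, |c * ell N * binVal δφ (φ' (Φ.flow t z i).1) *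
      (binVal δ₀ (ψ₀ (sv θ u₀ (Φ.flow t z i).2)) -
        binVal δ₀ (ψ₀ (sv θ u₀ (preVelOf (σ := σ) (Φ.flow t z) i))))| ≤ 4 * c * ell N * (b + δ₀) := by
    intro i
    have hφ : |binVal δφ (φ' (Φ.flow t z i).1)| ≤ 2 :=
      (abs_mul_floor_div_le hδφ (hφ1 _)).trans (by linarith)
    have hs : |binVal δ₀ (ψ₀ (sv θ u₀ (Φ.flow t z i).2))| ≤ b + δ₀ := abs_mul_floor_div_le hδ₀ (hψb _)
    have hr : |binVal δ₀ (ψ₀ (sv θ u₀ (preVelOf (σ := σ) (Φ.flow t z) i)))| ≤ b + δ₀ :=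
      abs_mul_floor_div_le hδ₀ (hψb _)
    rw [abs_mul, abs_mul, abs_mul, abs_of_nonneg hc, abs_of_nonneg hℓ]
    calc c * ell N * |binVal δφ (φ' (Φ.flow t z i).1)| *
          |binVal δ₀ (ψ₀ (sv θ u₀ (Φ.flow t z i).2)) -
            binVal δ₀ (ψ₀ (sv θ u₀ (preVelOf (σ := σ) (Φ.flow t z) i)))|
        ≤ c * ell N * 2 * ((b + δ₀) + (b + δ₀)) := by
          refine mul_le_mul (mul_le_mul_of_nonneg_left hφ (by positivity))
            ((abs_sub _ _).trans (add_le_add hs hr)) (abs_nonneg _) (by positivity)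
      _ = 4 * c * ell N * (b + δ₀) := by ring
  refine (abs_sum_ite_participates_and_le (Φ.isTrajectory z hz) t _ (by positivity) hterm).trans ?_
  unfold payloadCap
  linarith

/-! ## The pathwise identity and bound on the good set -/

/-- **The clamped binned jump process at the horizon, particle by particle.**  On the good set (for
meshes `0 < δφ ≤ 1`, `0 < δ₀`, `|φ'| ≤ 1`, `|ψ₀| ≤ b`, `c ≥ 0`, so that clipping is inactive),
`X̃ₘ = Σᵢ Σ_{n ≤ K, n < Jᵢ} cℓ·φ̃'(xᵢ(tⁱₙ))·(ψ̃₀(wᵢ(tⁱₙ)) - ψ̃₀(wᵢ(tⁱₙ⁻)))`, `tⁱₙ` the `n`-th collision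
time of `i`, `Jᵢ` its number of collisions in `(0, h]`. [folklore] -/
theorem procX_horizon_eq (θ : ℝ) (u₀ : V3) {φ' : T3 → ℝ} {ψ₀ : V3 → ℝ} {c b δφ δ₀ : ℝ}
    (hc : 0 ≤ c) (hφ1 : ∀ x, |φ' x| ≤ 1) (hψb : ∀ v, |ψ₀ v| ≤ b) (hδφ : 0 < δφ) (hδφ1 : δφ ≤ 1)
    (hδ₀ : 0 < δ₀) (K : ℕ) (τ : ℝ) (Φ : Flow σ N) {z : Phase N} (hz : z ∈ Φ.good) :
    procX θ u₀ φ' ψ₀ c b K τ δφ δ₀ Φ (horizon N K) z =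
      ∑ i, ∑ n ∈ Finset.range (K + 1),
        (if n < (collisionTimesOf (Torus.geometry (Fin 3)) (hsDiameter σ N) (fun s => Φ.flow s z) i ∩
            Set.Ioc 0 (window τ N)).ncard then
          c * ell N * binVal δφ (φ' (Φ.flow (Φ.nthCollisionTimeOf i n z) z i).1) *
            (binVal δ₀ (ψ₀ (sv θ u₀ (Φ.flow (Φ.nthCollisionTimeOf i n z) z i).2)) -
              binVal δ₀ (ψ₀ (sv θ u₀ (preVelOf (σ := σ) (Φ.flow (Φ.nthCollisionTimeOf i n z) z) i))))
        else 0) := by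
  have hRfin := finite_relTimes Φ K (window τ N) hz
  have hRsub : relTimes Φ K (window τ N) z ⊆ Set.Ioc 0 (window τ N) := fun _ ht => ht.2.1
  have hRdef := relTimes_eq Φ K (window τ N) hz
  have hRle : relCount Φ K (window τ N) z ≤ horizon N K := by
    unfold relCount horizon
    rw [hRdef]
    exact Φ.ncard_clampedTimes_le hz (window τ N) K
  have hY : ∀ n, payloadY θ u₀ φ' ψ₀ c b K τ δφ δ₀ Φ n z =
      if n < relCount Φ K (window τ N) z then
        ∑ i, payloadAt θ u₀ φ' ψ₀ c K (window τ N) δφ δ₀ Φ (relTime Φ K (window τ N) z n) z i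
      else 0 := by
    intro n
    unfold payloadY
    by_cases hn : n < relCount Φ K (window τ N) z
    · rw [if_pos ⟨hz, hn⟩, if_pos hn,
        clip_eq_self_of_abs_le (abs_sum_payloadAt_le θ u₀ hc hφ1 hψb hδφ hδφ1 hδ₀ K (window τ N) Φ hz _)]
    · rw [if_neg (fun h' => hn h'.2), if_neg hn]
  unfold procX
  rw [Finset.sum_congr rfl fun n _ => hY n, ← Finset.sum_filter]
  have hfilt : (Finset.range (horizon N K)).filter (fun n => n < relCount Φ K (window τ N) z) =
      Finset.range (relCount Φ K (window τ N) z) := by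
    ext n
    simp only [Finset.mem_filter, Finset.mem_range]
    omega
  rw [hfilt]
  unfold relCount relTime
  rw [sum_range_ncard_nthTimeAfter hRfin hRsub
    (fun t => ∑ i, payloadAt θ u₀ φ' ψ₀ c K (window τ N) δφ δ₀ Φ t z i)]
  refine Eq.trans ?_ (Φ.sum_clampedTimes_eq hz (window τ N) K hRfin hRdef fun t i =>
    c * ell N * binVal δφ (φ' (Φ.flow t z i).1) *
      (binVal δ₀ (ψ₀ (sv θ u₀ (Φ.flow t z i).2)) -
        binVal δ₀ (ψ₀ (sv θ u₀ (preVelOf (σ := σ) (Φ.flow t z) i)))))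
  refine Finset.sum_congr rfl fun t _ => Finset.sum_congr rfl fun i _ => ?_
  unfold payloadAt
  by_cases hP : Participates (Torus.geometry (Fin 3)) (hsDiameter σ N) (Φ.flow t z) i ∧
      t ≤ (if K + 1 ≤ (collisionTimesOf (Torus.geometry (Fin 3)) (hsDiameter σ N)
            (fun s => Φ.flow s z) i ∩ Set.Ioc 0 (window τ N)).ncard then
          max 0 (min (window τ N) (Φ.nthCollisionTimeOf i K z)) else window τ N)
  · rw [if_pos ((counted_eq_true_iff Φ K _ t i hz).2 hP), if_pos hP]
  · rw [if_neg (fun h' => hP ((counted_eq_true_iff Φ K _ t i hz).1 h')), if_neg hP]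

/-- **The deterministic pathwise bound** on the good set (regular geometry `ε < 1/2`):
`|X̃ₘ| ≤ (N+1)·cℓ·(2b + (K+1)(2δφ(b+δ₀)+2δ₀)) + cℓbD Σᵢ ∫₀ʰ ‖vᵢ(s)‖ ds`
(`HardSphereFlow.abs_sum_sum_range_ite_binnedJumpPayload_le`). [folklore] -/
theorem abs_procX_horizon_le (θ : ℝ) (u₀ : V3) {φ' : T3 → ℝ} {ψ₀ : V3 → ℝ} {c b D δφ δ₀ : ℝ}
    (hc : 0 ≤ c) (hφ1 : ∀ x, |φ' x| ≤ 1) (hD : 0 ≤ D) (hφD : ∀ x y, |φ' x - φ' y| ≤ D * dist x y)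
    (hψb : ∀ v, |ψ₀ v| ≤ b) (hδφ : 0 < δφ) (hδφ1 : δφ ≤ 1) (hδ₀ : 0 < δ₀) (K : ℕ) {τ : ℝ}
    (hτ : 0 < τ) (hε : hsDiameter σ N < 2⁻¹) (Φ : Flow σ N) {z : Phase N} (hz : z ∈ Φ.good) :
    |procX θ u₀ φ' ψ₀ c b K τ δφ δ₀ Φ (horizon N K) z| ≤
      (N + 1 : ℕ) * (c * ell N * (2 * b + ((K : ℝ) + 1) * (2 * δφ * (b + δ₀) + 2 * δ₀))) +
        c * ell N * b * D * ∑ i, ∫ s in (0 : ℝ)..window τ N, ‖(Φ.flow s z i).2‖ := by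
  rw [procX_horizon_eq θ u₀ hc hφ1 hψb hδφ hδφ1 hδ₀ K τ Φ hz]
  exact Φ.abs_sum_sum_range_ite_binnedJumpPayload_le hε hz (window_pos hτ N).le K
    (mul_nonneg hc (ell_pos N).le) hδφ hδ₀ hD hφ1 hφD (g := fun v => ψ₀ (sv θ u₀ v))
    (fun v => hψb _) 0

/-! ## Measurability -/

/-- **`X̃ₘ` is `G_N`-a.e. measurable**: on the conull good set it is the particle-by-particle sum,
a measurable function there (`HardSphereFlow.measurable_sum_ite_lt_ncard_comp_subtype_torus` with the
measurable binned payload `measurable_binnedJumpPayload`). [folklore] -/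
theorem aemeasurable_procX_horizon (a θ : ℝ) (u₀ : V3) {φ' : T3 → ℝ} {ψ₀ : V3 → ℝ} {c b δφ δ₀ : ℝ}
    (hφ : Continuous φ') (hψ : Continuous ψ₀) (hc : 0 ≤ c) (hφ1 : ∀ x, |φ' x| ≤ 1)
    (hψb : ∀ v, |ψ₀ v| ≤ b) (hδφ : 0 < δφ) (hδφ1 : δφ ≤ 1) (hδ₀ : 0 < δ₀) (K : ℕ) (τ : ℝ)
    (Φ : Flow σ N) :
    AEMeasurable (procX θ u₀ φ' ψ₀ c b K τ δφ δ₀ Φ (horizon N K)) (gibbs σ a θ u₀ N Φ) := by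
  have hgood : gibbs σ a θ u₀ N Φ Φ.goodᶜ = 0 := ae_iff.1 (ae_mem_good_localGibbsLaw σ _ _ _ N Φ)
  refine Φ.aemeasurable_of_measurable_comp_subtype ?_ hgood
  have hsv : Continuous fun v => ψ₀ (sv θ u₀ v) := by unfold sv; fun_prop
  have hF : ∀ i : Fin (N + 1), Measurable fun ζ : Phase N =>
      c * ell N * binVal δφ (φ' (ζ i).1) *
        (binVal δ₀ (ψ₀ (sv θ u₀ (ζ i).2)) - binVal δ₀ (ψ₀ (sv θ u₀ (preVelOf (σ := σ) ζ i)))) :=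
    fun i => measurable_binnedJumpPayload (N := N + 1) Torus.measurable_geometry_sepVec
      (hsDiameter σ N) 0 hφ.measurable hsv.measurable (c * ell N) δφ δ₀ i
  have hmeas := Φ.measurable_sum_ite_lt_ncard_comp_subtype_torus (F := fun ζ i =>
    c * ell N * binVal δφ (φ' (ζ i).1) *
      (binVal δ₀ (ψ₀ (sv θ u₀ (ζ i).2)) - binVal δ₀ (ψ₀ (sv θ u₀ (preVelOf (σ := σ) ζ i))))) hF K
    (window τ N)
  have heq : (fun z : Φ.good => procX θ u₀ φ' ψ₀ c b K τ δφ δ₀ Φ (horizon N K) (z : Phase N)) =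
      fun z : Φ.good => ∑ i, ∑ n ∈ Finset.range (K + 1),
        (if n < (collisionTimesOf (Torus.geometry (Fin 3)) (hsDiameter σ N)
            (fun s => Φ.flow s (z : Phase N)) i ∩ Set.Ioc 0 (window τ N)).ncard then
          c * ell N * binVal δφ (φ' (Φ.flow (Φ.nthCollisionTimeOf i n (z : Phase N)) (z : Phase N) i).1) *
            (binVal δ₀ (ψ₀ (sv θ u₀ (Φ.flow (Φ.nthCollisionTimeOf i n (z : Phase N)) (z : Phase N) i).2)) -
              binVal δ₀ (ψ₀ (sv θ u₀ (preVelOf (σ := σ)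
                (Φ.flow (Φ.nthCollisionTimeOf i n (z : Phase N)) (z : Phase N)) i))))
        else 0) :=
    funext fun z => procX_horizon_eq θ u₀ hc hφ1 hψb hδφ hδφ1 hδ₀ K τ Φ z.2
  rw [heq]
  exact hmeas

/-! ## The pressure bound -/

/-- The scale `ℓ_N` tends to zero (it is the diameter at reduced density one). [folklore] -/
theorem tendsto_ell_zero : Tendsto ell atTop (nhds 0) := by
  have h := tendsto_hsDiameter 1
  refine h.congr fun N => ?_
  simp [ell, hsDiameter]

/-- **The tilted integrand on the good set**: with the thresholds of
`clampedJump_deterministic_budget_le`, `p h⁻¹ X̃ₘ ≤ (2δ/3)(N+1) + h⁻¹ ∫₀ʰ Σᵢ t ‖vᵢ(s)‖ ds`,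
`t = |p|cℓbD`. [folklore] -/
theorem mul_windowInv_procX_le (θ : ℝ) (u₀ : V3) {φ' : T3 → ℝ} {ψ₀ : V3 → ℝ}
    {p c b D k δ δφ δ₀ r₀ τ : ℝ} (hc : 0 < c) (hb : 0 < b) (hD : 0 ≤ D) (hk : 0 < k) (hδ : 0 < δ)
    (hφ1 : ∀ x, |φ' x| ≤ 1) (hφD : ∀ x y, |φ' x - φ' y| ≤ D * dist x y) (hψb : ∀ v, |ψ₀ v| ≤ b)
    (hδφ : 0 < δφ) (hδφr : δφ ≤ r₀) (hδ₀ : 0 < δ₀) (hδ₀r : δ₀ ≤ r₀) (hr1 : r₀ ≤ 1)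
    (hr : (|p| + 1) * c * (k + 2) * (r₀ * (2 * (b + 1) + 2)) ≤ δ / 3) (hτ1 : 1 ≤ τ)
    (hτ : 6 * ((|p| + 1) * c) * b / δ ≤ τ) (hε : hsDiameter σ N < 2⁻¹) (Φ : Flow σ N) {z : Phase N}
    (hz : z ∈ Φ.good) :
    p * ((window τ N)⁻¹ * procX θ u₀ φ' ψ₀ c b ⌈k * τ⌉₊ τ δφ δ₀ Φ (horizon N ⌈k * τ⌉₊) z) ≤
      2 * δ / 3 * (N + 1) + (window τ N)⁻¹ * ∫ s in (0 : ℝ)..window τ N,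
        ∑ i, |p| * c * ell N * b * D * ‖(Φ.flow s z i).2‖ := by
  have hτ0 : 0 < τ := lt_of_lt_of_le one_pos hτ1
  have hw := window_pos hτ0 N
  have hℓ := ell_pos N
  set X := procX θ u₀ φ' ψ₀ c b ⌈k * τ⌉₊ τ δφ δ₀ Φ (horizon N ⌈k * τ⌉₊) z with hX
  have hXle := abs_procX_horizon_le θ u₀ hc.le hφ1 hD hφD hψb hδφ (hδφr.trans hr1) hδ₀ ⌈k * τ⌉₊ hτ0
    hε Φ hz
  rw [← hX] at hXle
  have hbud := clampedJump_deterministic_budget_le (p := p) hc hb hk hδ hδφ hδφr hδ₀ hδ₀r hr1 hr hτ1 hτ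
  have hint : ∫ s in (0 : ℝ)..window τ N, ∑ i, |p| * c * ell N * b * D * ‖(Φ.flow s z i).2‖ =
      ∑ i, |p| * c * ell N * b * D * ∫ s in (0 : ℝ)..window τ N, ‖(Φ.flow s z i).2‖ := by
    rw [intervalIntegral.integral_finsetSum]
    · exact Finset.sum_congr rfl fun i _ => intervalIntegral.integral_const_mul _ _
    · exact fun i _ => (Φ.intervalIntegrable_norm_vel_flow hz i _ _).const_mul _
  rw [hint]
  have h1 : p * ((window τ N)⁻¹ * X) ≤ |p| * (window τ N)⁻¹ * |X| := by
    calc p * ((window τ N)⁻¹ * X) ≤ |p * ((window τ N)⁻¹ * X)| := le_abs_self _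
      _ = |p| * (window τ N)⁻¹ * |X| := by
          rw [abs_mul, abs_mul, abs_of_pos (inv_pos.2 hw), mul_assoc]
  refine h1.trans ?_
  have hL0 : 0 ≤ ∑ i, ∫ s in (0 : ℝ)..window τ N, ‖(Φ.flow s z i).2‖ :=
    Finset.sum_nonneg fun i _ => Φ.integral_norm_vel_flow_nonneg z i hw.le
  calc |p| * (window τ N)⁻¹ * |X|
      ≤ |p| * (window τ N)⁻¹ * ((N + 1 : ℕ) *
          (c * ell N * (2 * b + ((⌈k * τ⌉₊ : ℝ) + 1) * (2 * δφ * (b + δ₀) + 2 * δ₀))) +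
            c * ell N * b * D * ∑ i, ∫ s in (0 : ℝ)..window τ N, ‖(Φ.flow s z i).2‖) :=
        mul_le_mul_of_nonneg_left hXle (by positivity)
    _ = |p| * c * (2 * b + ((⌈k * τ⌉₊ : ℝ) + 1) * (2 * δφ * (b + δ₀) + 2 * δ₀)) / τ * (N + 1) +
          (window τ N)⁻¹ * ∑ i, |p| * c * ell N * b * D *
            ∫ s in (0 : ℝ)..window τ N, ‖(Φ.flow s z i).2‖ := by
        rw [← Finset.mul_sum, window_eq]
        push_cast
        field_simp
    _ ≤ 2 * δ / 3 * (N + 1) + (window τ N)⁻¹ * ∑ i, |p| * c * ell N * b * D *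
            ∫ s in (0 : ℝ)..window τ N, ‖(Φ.flow s z i).2‖ :=
        add_le_add (mul_le_mul_of_nonneg_right hbud (by positivity)) le_rfl

/-- **Registered stub S3 `stub_clampedJumpPressure`** of the line `dynkin-azuma-collision-innovations`
(crux stmt-AtomisticToContinuum-10967): the clamped, binned collision-jump process `X̃` at the horizon
has vanishing pressure at every tilt and is `G_N`-a.e. measurable. [folklore] -/
theorem stub_clampedJumpPressure :
    ∀ (a θ : ℝ) (u₀ : V3), 0 < a → 0 < θ → ∀ σ : ℝ, 0 < σ → σ ≤ 1 / 2 →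
      ∀ (p c b D k δ : ℝ), 0 < c → 0 < b → 0 < D → 0 < k → 0 < δ →
        ∃ r₀ : ℝ, 0 < r₀ ∧ ∀ (δφ δ₀ : ℝ), 0 < δφ → δφ ≤ r₀ → 0 < δ₀ → δ₀ ≤ r₀ →
          ∃ τ₀ : ℝ, 0 < τ₀ ∧ ∀ τ : ℝ, τ₀ ≤ τ → ∃ N₀ : ℕ, ∀ N : ℕ, N₀ ≤ N → ∀ Φ : Flow σ N,
            ∀ (φ' : T3 → ℝ) (ψ₀ : V3 → ℝ), Continuous φ' → (∀ x, |φ' x| ≤ 1) →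
              (∀ x y, |φ' x - φ' y| ≤ D * dist x y) → Continuous ψ₀ → (∀ v, |ψ₀ v| ≤ b) →
              AEMeasurable (procX θ u₀ φ' ψ₀ c b ⌈k * τ⌉₊ τ δφ δ₀ Φ (horizon N ⌈k * τ⌉₊))
                  (gibbs σ a θ u₀ N Φ) ∧
              ∫⁻ z, ENNReal.ofReal (Real.exp (p * ((window τ N)⁻¹ *
                  procX θ u₀ φ' ψ₀ c b ⌈k * τ⌉₊ τ δφ δ₀ Φ (horizon N ⌈k * τ⌉₊) z)))
                  ∂(gibbs σ a θ u₀ N Φ) ≤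
                ENNReal.ofReal (Real.exp (δ * (N + 1))) := by
  intro a θ u₀ ha hθ σ hσ hσ2 p c b D k δ hc hb hD hk hδ
  -- the mesh threshold `r₀`
  set A := (|p| + 1) * c with hA
  have hA0 : 0 < A := by rw [hA]; positivity
  set M := 2 * (b + 1) + 2 with hM
  have hM0 : 0 < M := by rw [hM]; positivity
  refine ⟨min 1 (δ / 3 / (A * (k + 2) * M)), lt_min one_pos (by positivity), ?_⟩
  intro δφ δ₀ hδφ hδφr hδ₀ hδ₀r
  have hr1 : min 1 (δ / 3 / (A * (k + 2) * M)) ≤ 1 := min_le_left _ _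
  have hr : A * (k + 2) * (min 1 (δ / 3 / (A * (k + 2) * M)) * M) ≤ δ / 3 := by
    calc A * (k + 2) * (min 1 (δ / 3 / (A * (k + 2) * M)) * M)
        ≤ A * (k + 2) * (δ / 3 / (A * (k + 2) * M) * M) :=
          mul_le_mul_of_nonneg_left (mul_le_mul_of_nonneg_right (min_le_right _ _) hM0.le)
            (by positivity)
      _ = δ / 3 := by field_simp
  -- the window threshold `τ₀`
  refine ⟨max 1 (6 * A * b / δ), lt_max_iff.2 (Or.inl one_pos), ?_⟩
  intro τ hτ
  have hτ1 : 1 ≤ τ := (le_max_left _ _).trans hτ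
  have hτ6 : 6 * A * b / δ ≤ τ := (le_max_right _ _).trans hτ
  have hτ0 : 0 < τ := lt_of_lt_of_le one_pos hτ1
  -- the Gaussian one-site threshold and `N₀`
  obtain ⟨t₀, ht₀, hgauss⟩ :=
    exists_lintegral_exp_mul_norm_le_of_isGaussian (gaussMeasure u₀ θ) (η := δ / 3) (by positivity)
  have hev : ∀ᶠ N : ℕ in atTop, ell N ≤ t₀ / (A * b * D) :=
    tendsto_ell_zero.eventually_le_const (by positivity)
  obtain ⟨N₁, hN₁⟩ := Filter.eventually_atTop.1 hev
  refine ⟨max 1 N₁, ?_⟩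
  intro N hN Φ φ' ψ₀ hφc hφ1 hφD hψc hψb
  have hN1 : 1 ≤ N := (le_max_left _ _).trans hN
  have hNℓ : ell N ≤ t₀ / (A * b * D) := hN₁ N ((le_max_right _ _).trans hN)
  have hε : hsDiameter σ N < 2⁻¹ :=
    hsDiameter_lt_half_of_ne_zero hσ (hσ2.trans_eq (by norm_num)) (Nat.one_le_iff_ne_zero.1 hN1)
  have hδφ1 : δφ ≤ 1 := hδφr.trans hr1
  refine ⟨aemeasurable_procX_horizon a θ u₀ hφc hψc hc.le hφ1 hψb hδφ hδφ1 hδ₀ _ τ Φ, ?_⟩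
  -- the streaming coupling `t = |p| c ℓ b D ≤ t₀`
  have hℓ := ell_pos N
  have ht0 : 0 ≤ |p| * c * ell N * b * D := by positivity
  have htt₀ : |p| * c * ell N * b * D ≤ t₀ := by
    have hpA : |p| * c ≤ A := by rw [hA]; nlinarith [abs_nonneg p]
    calc |p| * c * ell N * b * D ≤ A * ell N * b * D := by gcongr
      _ = A * b * D * ell N := by ring
      _ ≤ A * b * D * (t₀ / (A * b * D)) := mul_le_mul_of_nonneg_left hNℓ (by positivity)
      _ = t₀ := by field_simp
  -- pressure domination by the one-body window average of `t ‖v‖`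
  have hqc : Continuous fun y : T3 × V3 => |p| * c * ell N * b * D * ‖y.2‖ :=
    continuous_const.mul (continuous_norm.comp continuous_snd)
  have hC : ∀ x : T3, ∫⁻ v, ENNReal.ofReal (Real.exp ((fun y : T3 × V3 =>
      |p| * c * ell N * b * D * ‖y.2‖) (x, v))) ∂(gaussMeasure u₀ θ) ≤
      ENNReal.ofReal (Real.exp (δ / 3)) := fun x => hgauss _ ht0 htt₀
  have hmain := lintegral_exp_le_of_le_windowAvg_sum_localGibbsLaw_const ha hθ u₀ hσ2 N Φ
    (measurePreserving_flow_localGibbsLaw_const σ a θ u₀ N Φ) hqc hC (window_pos hτ0 N)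
    (A := fun z => p * ((window τ N)⁻¹ *
      procX θ u₀ φ' ψ₀ c b ⌈k * τ⌉₊ τ δφ δ₀ Φ (horizon N ⌈k * τ⌉₊) z))
    (α := 2 * δ / 3 * (N + 1)) fun z hz =>
      mul_windowInv_procX_le θ u₀ hc hb hD.le hk hδ hφ1 hφD hψb hδφ hδφr hδ₀ hδ₀r hr1 hr hτ1 hτ6
        hε Φ hz
  refine hmain.trans (le_of_eq ?_)
  rw [← ENNReal.ofReal_pow (Real.exp_nonneg _), ← ENNReal.ofReal_mul (Real.exp_nonneg _),
    ← Real.exp_nat_mul, ← Real.exp_add]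
  congr 2
  push_cast
  ring

end Summit.AtomisticToContinuum.HydrodynamicLimit.Theorems.DynkinAzuma

end
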